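import Literature.Analysis.FluidPDE.ElgindiProfileDefect
import Literature.Analysis.FluidPDE.ElgindiClosureStream
import HarnessLib

/-!
# The structure of the stream function of the profile: `Φ_* = a(z) sin 2θ + r(z)ψ₁(θ) + Φ_rem`
with `Φ_rem = O(α²)` in Elgindi's `𝓗⁴`-energies ([Elgindi2021] §8.3 Proposition 8.13;
[ElgindiGhoulMasmoudi2021] §2.3.1 (2.10)–(2.12))

Topic `Literature/Analysis/FluidPDE`. Support file (definitions with bodies and proved theorems, no
named facts) on the proof path of the named fact
`Literature.Analysis.FluidPDE.Elgindi.ElgindiGhoulMasmoudi2021_stabilityCore`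
(`ElgindiStabilityDecomposition.lean`). T. M. Elgindi, Ann. of Math. 194 (2021) =
arXiv:1904.04795, §8.3 Proposition 8.13 (p. 27): "`Φ_* = (1/4α) sin(2θ) L₁₂(F_*) + 𝓡`, with `𝓡`
of order `α`"; Elgindi–Ghoul–Masmoudi, arXiv:1910.14071, §2.3.1 (p. 9), (2.10)–(2.12).

We follow the printed proof (subtract the explicit `sin 2θ`-mode, solve the remainder by Theorem 2),
made exact at `z → 0` so that the remainder datum lies in `𝓗⁴` (weight `w = (1+z)²/z²`):
* `L_α(g ⊗ a) = (L_zg) ⊗ a + g ⊗ (L_θa)` with `L_z = −α²D_z² − 5αD_z`,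
  `L_θ = −∂_θθ + ∂_θ(tan θ ·) − 6` (`ellipticOp_tensor`);
* the radial mode `a = radialMode α` has `L_za = 5αz/(1+z)²` exactly (`ElgindiRadialProfileMode`), so
  `L_α(a ⊗ sin 2θ) = (5αz/(1+z)²) sin 2θ` (`L_θ sin 2θ = 0`);
* the angular corrector `ψ₁` solves `(L_θ + μ₁)ψ₁ = Γ̄ = Γ − (5c/4) sin 2θ` (`ElgindiAngularCorrectorODE`),
  and `(L_z − μ₁)r = −defectRadial α` for `r = (4α/c)z/(1+z)²` (`μ₁ = −α(α+5)` is the eigenvalue of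
  `L_z` on `z`), so `L_α(r ⊗ ψ₁) = F_* − (5αz/(1+z)²) sin 2θ − D`, `D = defectDatum α = O(α²)` in `𝓗⁴`
  (`ElgindiProfileDefect`);
* hence `L_αΦ_app = F_* − D` for `Φ_app = a ⊗ sin 2θ + r ⊗ ψ₁` (`ellipticOp_phiApp`), and Theorem 2
  in the closure class (`theoremTwo_of_finite_L12`, no corrector since `L₁₂(D) = 0`) produces
  `Φ_rem ∈ C^∞(strip)` with `L_αΦ_rem = D` and
  `|∂_θθΦ_rem|²_{𝓗⁴} + |α²D_z²Φ_rem|²_{𝓗⁴} + |α²D_zΦ_rem|²_{𝓗⁴} ≤ C·Kα⁴` (`phiStar_structure`):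
  `Φ_* := Φ_app + Φ_rem` solves `L_αΦ_* = F_*` on the strip.
-/

noncomputable section

open Set Real Filter MeasureTheory Function
open _root_.Topology
open scoped ENNReal ContDiff

namespace Literature.Analysis.FluidPDE

namespace Elgindi

/-! ### `L_α` on separable products and sums -/

/-- **`L_α(g ⊗ a) = (L_zg)·a + g·(L_θa)` on the strip** for `g ∈ C²(0,∞)`:
`L_z = −α²D_z² − 5αD_z`, `L_θa = −a″ + (tan θ·a)′ − 6a`. [cite: Elgindi2021, §7.5 (p. 24 of arXiv:1904.04795) and §8.3 (p. 27): separation of variables for L] -/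
theorem ellipticOp_tensor (α : ℝ) {g : ℝ → ℝ} (a : ℝ → ℝ) (hg : ContDiffOn ℝ 2 g (Ioi 0)) {p : ℝ × ℝ} (hp : p ∈ strip) :
    ellipticOp α (tensor g a) p.1 p.2 = -(α ^ 2 * Dz₁ (Dz₁ g) p.1 + 5 * α * Dz₁ g p.1) * a p.2 +
      g p.1 * (-deriv (deriv a) p.2 + deriv (fun θ => Real.tan θ * a θ) p.2 - 6 * a p.2) := by
  have hg' : ContDiffOn ℝ 1 (deriv g) (Ioi 0) := (hg.deriv_of_isOpen isOpen_Ioi (by norm_num))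
  have hd2 : DifferentiableAt ℝ (deriv g) p.1 := (hg'.differentiableOn (by norm_num)).differentiableAt (Ioi_mem_nhds hp.1)
  have eDz : Dz₁ (Dz₁ g) p.1 = p.1 * (deriv g p.1 + p.1 * deriv (deriv g) p.1) := by
    rw [Dz₁_apply]
    have e : Dz₁ g = fun z => z * deriv g z := rfl
    have h : HasDerivAt (fun z => z * deriv g z) (1 * deriv g p.1 + p.1 * deriv (deriv g) p.1) p.1 := (hasDerivAt_id p.1).mul hd2.hasDerivAt
    rw [e, h.deriv]; ring
  unfold ellipticOp
  rw [dz_tensor, dz_tensor, dθ_tensor, dθ_tensor]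
  have e5 : dθ (fun z' θ' => Real.tan θ' * tensor g a z' θ') p.1 p.2 = g p.1 * deriv (fun θ => Real.tan θ * a θ) p.2 := by
    show deriv (fun θ' => Real.tan θ' * (g p.1 * a θ')) p.2 = _
    rw [show (fun θ' => Real.tan θ' * (g p.1 * a θ')) = fun θ' => g p.1 * (Real.tan θ' * a θ') by funext θ'; ring,
      deriv_const_mul_field]
  rw [e5]
  simp only [tensor_apply, Dz₁_apply] at eDz ⊢
  rw [eDz]
  ring

/-- **`L_α(f + g) = L_αf + L_αg` on the strip** for `f, g ∈ C^∞(strip)`. [folklore] -/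
theorem ellipticOp_add_strip (α : ℝ) {f g : ℝ → ℝ → ℝ} (hf : ContDiffOn ℝ ∞ (uncurry f) strip) (hg : ContDiffOn ℝ ∞ (uncurry g) strip)
    {p : ℝ × ℝ} (hp : p ∈ strip) :
    ellipticOp α (fun R θ => f R θ + g R θ) p.1 p.2 = ellipticOp α f p.1 p.2 + ellipticOp α g p.1 p.2 := by
  have hF : ContDiffOn ℝ ∞ (uncurry fun R θ => f R θ + g R θ) strip := hf.add hg
  have h := ellipticOp_sub_strip α hF hg hp
  have e : (fun R θ => (fun R θ => f R θ + g R θ) R θ - g R θ) = f := by funext R θ; simp only; ring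
  rw [e] at h
  linarith

/-! ### The two explicit pieces -/

/-- **`(L_z − μ₁)r = −defectRadial α`** for `r = profileRadial α = (4α/c)z/(1+z)²`, on `z > 0`. [cite: Elgindi2021, §8.3 (p. 27 of arXiv:1904.04795)] -/
theorem Lz_sub_muOne_profileRadial (α : ℝ) {z : ℝ} (hz : 0 < z) :
    -(α ^ 2 * Dz₁ (Dz₁ (profileRadial α)) z + 5 * α * Dz₁ (profileRadial α) z) - muOne α * profileRadial α z = -defectRadial α z := by
  have e0 : profileRadial α = fun w => 4 * α / profileConst α * (fun w : ℝ => w / (1 + w) ^ 2) w := rfl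
  have e1 : Dz₁ (profileRadial α) = fun w => 4 * α / profileConst α * Dz₁ (fun w : ℝ => w / (1 + w) ^ 2) w := by
    rw [e0, Dz₁_const_mul]
  have e2 : Dz₁ (Dz₁ (profileRadial α)) = fun w => 4 * α / profileConst α * Dz₁ (Dz₁ fun w : ℝ => w / (1 + w) ^ 2) w := by
    rw [e1, Dz₁_const_mul]
  rw [e2, e1]
  have h := Lz_sub_muOne_shapeR0 α hz
  simp only [defectRadial, muOne, profileRadial]
  linear_combination (4 * α / profileConst α) * h

/-- `profileRadial α ∈ C^∞(0,∞)`. [folklore] -/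
theorem contDiffOn_profileRadial (α : ℝ) : ContDiffOn ℝ ∞ (profileRadial α) (Ioi 0) := by
  have h : ContDiffOn ℝ ∞ (fun w : ℝ => w / (1 + w) ^ 2) (Ioi 0) :=
    ContDiffOn.div (by fun_prop) (by fun_prop) fun w hw => by simp only [mem_Ioi] at hw; positivity
  exact (contDiffOn_const.mul h).congr fun w _ => rfl

section pieces

variable {α : ℝ} (hα : 0 < α) (hα' : α ≤ 1 / 200)
include hα hα'

/-- **`L_α(ψ₁`-tensor`)`**: for `g ∈ C²(0,∞)`, on the strip,
`L_α(g ⊗ ψ₁) = ((L_z − μ₁)g)·ψ₁ + g·Γ̄` (`(L_θ + μ₁)ψ₁ = Γ̄`). [cite: Elgindi2021, §8.3 Proposition 8.13 (p. 27 of arXiv:1904.04795)] -/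
theorem ellipticOp_tensor_psiOne {g : ℝ → ℝ} (hg : ContDiffOn ℝ 2 g (Ioi 0)) {p : ℝ × ℝ} (hp : p ∈ strip) :
    ellipticOp α (tensor g (psiOne α)) p.1 p.2 =
      (-(α ^ 2 * Dz₁ (Dz₁ g) p.1 + 5 * α * Dz₁ g p.1) - muOne α * g p.1) * psiOne α p.2 + g p.1 * gammaBar α p.2 := by
  rw [ellipticOp_tensor α (psiOne α) hg hp]
  have hθ : p.2 ∈ Ioo 0 (π / 2) := hp.2
  have e1 : deriv (deriv (psiOne α)) p.2 = psiOneDD α p.2 := by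
    have hev : deriv (psiOne α) =ᶠ[𝓝 p.2] psiOneD α := by
      filter_upwards [isOpen_Ioo.mem_nhds hθ] with θ hθ' using deriv_psiOne hα hα' hθ'
    rw [hev.deriv_eq, deriv_psiOneD hα hα' hθ]
  have e2 : deriv (fun θ => Real.tan θ * psiOne α θ) p.2 = Real.cos p.2 * chiOne α p.2 + Real.sin p.2 * chiOneD α p.2 :=
    (hasDerivAt_tan_mul_psiOne hα hα' hθ).deriv
  rw [e1, e2]
  have h := angularOp_psiOne (α := α) p.2
  linear_combination (g p.1) * h

/-- **`L_α(r ⊗ ψ₁) = F_* − (5αz/(1+z)²) sin 2θ − D` on the strip.** [cite: Elgindi2021, §8.3 Proposition 8.13 (p. 27 of arXiv:1904.04795)] -/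
theorem ellipticOp_tensor_profileRadial_psiOne {p : ℝ × ℝ} (hp : p ∈ strip) :
    ellipticOp α (tensor (profileRadial α) (psiOne α)) p.1 p.2 =
      fundamentalProfile α p.1 p.2 - 5 * α * p.1 / (1 + p.1) ^ 2 * Real.sin (2 * p.2) - defectDatum α p.1 p.2 := by
  have hz : (0:ℝ) < p.1 := hp.1
  rw [ellipticOp_tensor_psiOne hα hα' (contDiffOn_infty.1 (contDiffOn_profileRadial α) 2) hp,
    Lz_sub_muOne_profileRadial α hz]
  have hc : profileConst α ≠ 0 := (profileConst_pos hα.le).ne'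
  have hz1 : (1 + p.1) ≠ 0 := by positivity
  simp only [defectDatum, tensor_apply, gammaBar, fundamentalProfile, profileRadial]
  field_simp
  ring

/-- **`L_α(a ⊗ sin 2θ) = (5αz/(1+z)²) sin 2θ` on the strip** for the radial mode `a = radialMode α`. [cite: Elgindi2021, §8.3 Proposition 8.13 (p. 27 of arXiv:1904.04795): "we see Φ_* = (1/4α) sin(2θ)L₁₂(F_*) + …"] -/
theorem ellipticOp_tensor_radialMode_sin2 {p : ℝ × ℝ} (hp : p ∈ strip) :
    ellipticOp α (tensor (radialMode α) sin2) p.1 p.2 = 5 * α * p.1 / (1 + p.1) ^ 2 * Real.sin (2 * p.2) := by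
  have hα5 : α ≤ 5 := by linarith
  have hz : (0:ℝ) < p.1 := hp.1
  rw [ellipticOp_tensor_sin2 α (contDiffOn_infty.1 (contDiffOn_radialMode hα hα5) 2) hp]
  have h := Lz_radialMode hα hα5 hz
  linear_combination (Real.sin (2 * p.2)) * h

end pieces

/-! ### The approximate stream function `Φ_app` -/

/-- **`Φ_app = a(z) sin 2θ + r(z)ψ₁(θ)`**, the explicit part of `Φ_*`. [cite: Elgindi2021, §8.3 Proposition 8.13 (p. 27 of arXiv:1904.04795); ElgindiGhoulMasmoudi2021, §2.3.1 (2.10)–(2.12) (p. 9 of arXiv:1910.14071)] -/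
def phiApp (α : ℝ) : ℝ → ℝ → ℝ := fun z θ => radialMode α z * Real.sin (2 * θ) + profileRadial α z * psiOne α θ

/-- `Φ_app` as a sum of two tensors. [folklore] -/
theorem phiApp_eq (α : ℝ) : phiApp α = fun z θ => tensor (radialMode α) sin2 z θ + tensor (profileRadial α) (psiOne α) z θ := by
  funext z θ; simp only [phiApp, tensor_apply, sin2]

/-- `Φ_app(z, 0) = 0`. [folklore] -/
theorem phiApp_zero_right {α : ℝ} (hα : 0 < α) (hα' : α ≤ 1 / 200) (z : ℝ) : phiApp α z 0 = 0 := by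
  simp [phiApp, psiOne_zero hα hα']

/-- `Φ_app(z, π/2) = 0`. [folklore] -/
theorem phiApp_pi_div_two (α z : ℝ) : phiApp α z (π / 2) = 0 := by
  have h1 : Real.sin (2 * (π / 2)) = 0 := by rw [show 2 * (π / 2) = π by ring]; exact Real.sin_pi
  simp [phiApp, psiOne_pi_div_two, h1]

section app

variable {α : ℝ} (hα : 0 < α) (hα' : α ≤ 1 / 200)
include hα hα'

/-- `a ⊗ sin 2θ ∈ C^∞(strip)`. [folklore] -/
theorem contDiffOn_tensor_radialMode_sin2 : ContDiffOn ℝ ∞ (uncurry (tensor (radialMode α) sin2)) strip :=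
  contDiffOn_tensor_strip (contDiffOn_radialMode hα (by linarith)) (by unfold sin2; fun_prop)

/-- `r ⊗ ψ₁ ∈ C^∞(strip)`. [folklore] -/
theorem contDiffOn_tensor_profileRadial_psiOne : ContDiffOn ℝ ∞ (uncurry (tensor (profileRadial α) (psiOne α))) strip :=
  contDiffOn_tensor (contDiffOn_profileRadial α) (contDiffOn_psiOne hα hα')

/-- **`Φ_app ∈ C^∞(strip)`.** [folklore] -/
theorem contDiffOn_phiApp : ContDiffOn ℝ ∞ (uncurry (phiApp α)) strip := by
  rw [phiApp_eq]
  exact (contDiffOn_tensor_radialMode_sin2 hα hα').add (contDiffOn_tensor_profileRadial_psiOne hα hα')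

/-- **`Φ_app` is continuous up to the sides `θ = 0, π/2`.** [folklore] -/
theorem continuousOn_phiApp : ContinuousOn (uncurry (phiApp α)) (Ioi 0 ×ˢ Icc 0 (π / 2)) := by
  have h1 : ContinuousOn (fun p : ℝ × ℝ => radialMode α p.1) (Ioi 0 ×ˢ Icc 0 (π / 2)) :=
    (contDiffOn_radialMode hα (by linarith)).continuousOn.comp continuousOn_fst fun p hp => hp.1
  have h2 : ContinuousOn (fun p : ℝ × ℝ => profileRadial α p.1) (Ioi 0 ×ˢ Icc 0 (π / 2)) :=
    (contDiffOn_profileRadial α).continuousOn.comp continuousOn_fst fun p hp => hp.1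
  have h3 : Continuous fun p : ℝ × ℝ => Real.sin (2 * p.2) := by fun_prop
  have h4 : Continuous fun p : ℝ × ℝ => psiOne α p.2 := by
    unfold psiOne
    exact (Real.continuous_cos.comp continuous_snd).mul ((chiOne α).continuous.comp continuous_snd)
  exact ((h1.mul h3.continuousOn).add (h2.mul h4.continuousOn)).congr fun p _ => rfl

/-- **`L_αΦ_app = F_* − D` on the strip** (`D = defectDatum α`). [cite: Elgindi2021, §8.3 Proposition 8.13 (p. 27 of arXiv:1904.04795)] -/
theorem ellipticOp_phiApp {p : ℝ × ℝ} (hp : p ∈ strip) :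
    ellipticOp α (phiApp α) p.1 p.2 = fundamentalProfile α p.1 p.2 - defectDatum α p.1 p.2 := by
  rw [phiApp_eq, ellipticOp_add_strip α (contDiffOn_tensor_radialMode_sin2 hα hα') (contDiffOn_tensor_profileRadial_psiOne hα hα') hp,
    ellipticOp_tensor_radialMode_sin2 hα hα' hp, ellipticOp_tensor_profileRadial_psiOne hα hα' hp]
  ring

/-! ### The remainder by Theorem 2 and the structure theorem -/

/-- **`Φ_app` is a classical stream function of `F_* − D`.** [cite: Elgindi2021, §8.3 Proposition 8.13 (p. 27 of arXiv:1904.04795)] -/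
theorem isStreamFunction_phiApp :
    IsStreamFunction α (fun z θ => fundamentalProfile α z θ - defectDatum α z θ) (phiApp α) where
  contDiffOn := contDiffOn_infty.1 (contDiffOn_phiApp hα hα') 2
  continuousOn := continuousOn_phiApp hα hα'
  elliptic z θ hp := ellipticOp_phiApp hα hα' (p := (z, θ)) hp
  bc_zero z _ := phiApp_zero_right hα hα' z
  bc_pi_div_two z _ := phiApp_pi_div_two α z

/-- **The remainder `Φ_rem`**: a classical stream function of `D` (smooth on the strip, continuous up to
the sides with the Dirichlet values) with the Theorem-2 bounds
`|∂_θθΦ_rem|² + |α²D_z²Φ_rem|² + |α²D_zΦ_rem|² ≤ C|D|²` in `𝓗⁴` (no `L₁₂`-corrector: `L₁₂(D) = 0`) and the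
local Hardy membership `Φ_rem²/sin²(2θ) ∈ L¹_loc`. [cite: Elgindi2021, §7.5 Theorem 2 (p. 24 of arXiv:1904.04795) with §8.1 Remark 8.3 (p. 27)] -/
theorem exists_phiRem :
    ∃ Φr : ℝ → ℝ → ℝ, ContDiffOn ℝ ∞ (uncurry Φr) strip ∧ IsStreamFunction α (defectDatum α) Φr ∧
      eHkNormSq α 4 (dθ (dθ Φr)) + eHkNormSq α 4 ((α ^ 2) • (Dz^[2] Φr)) + eHkNormSq α 4 ((α ^ 2) • Dz Φr) ≤
        thmTwoC * eHkNormSq α 4 (defectDatum α) ∧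
      ∀ a b : ℝ, 0 < a → a < b → IntegrableOn (fun p : ℝ × ℝ => Φr p.1 p.2 ^ 2 / Real.sin (2 * p.2) ^ 2) (Ioo a b ×ˢ Ioo 0 (π / 2)) := by
  have hα4 : α ≤ 1 / 4 := by linarith
  obtain ⟨Ψ, hΨs, hΨst, -, hΨb, hΨH⟩ := exists_isStreamFunction_of_finite hα hα4 (contDiffOn_defectDatum hα hα')
    (eHkNormSq_defectDatum_lt_top hα hα') (gammaWords_defectDatum_lt_top hα hα')
  refine ⟨Ψ, hΨs, hΨst, ?_, hΨH⟩
  have hL : L12 (defectDatum α) = fun _ => 0 := funext fun z => L12_defectDatum hα hα' z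
  have e : corrQ α Ψ (L12 (defectDatum α)) = dθ (dθ Ψ) := by
    funext z θ
    simp only [corrQ, hL, Pi.add_apply, Pi.smul_apply, tensor_apply, smul_eq_mul, zero_mul, mul_zero, add_zero]
  rw [e] at hΨb
  exact hΨb

end app

/-- **Sums of classical stream functions** (for stream functions smooth on the strip). [folklore] -/
theorem IsStreamFunction.add_of_smooth {α : ℝ} {W₁ W₂ Φ₁ Φ₂ : ℝ → ℝ → ℝ} (h₁ : IsStreamFunction α W₁ Φ₁) (h₂ : IsStreamFunction α W₂ Φ₂)
    (hs₁ : ContDiffOn ℝ ∞ (uncurry Φ₁) strip) (hs₂ : ContDiffOn ℝ ∞ (uncurry Φ₂) strip) :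
    IsStreamFunction α (fun z θ => W₁ z θ + W₂ z θ) (fun z θ => Φ₁ z θ + Φ₂ z θ) where
  contDiffOn := h₁.contDiffOn.add h₂.contDiffOn
  continuousOn := h₁.continuousOn.add h₂.continuousOn
  elliptic z θ hp := by
    rw [ellipticOp_add_strip α hs₁ hs₂ (p := (z, θ)) hp, h₁.elliptic z θ hp, h₂.elliptic z θ hp]
  bc_zero z hz := by simp [h₁.bc_zero z hz, h₂.bc_zero z hz]
  bc_pi_div_two z hz := by simp [h₁.bc_pi_div_two z hz, h₂.bc_pi_div_two z hz]

/-- **Elgindi's Proposition 8.13 (structure of `Φ_*`), exact form, with the stream function.** There is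
an absolute `K` such that for `0 < α ≤ 1/200` the Biot–Savart problem `L_αΦ = F_*` with its Dirichlet
conditions has the classical solution `Φ_* = Φ_app + Φ_rem` (`IsStreamFunction α F_* Φ_*`),
`Φ_app = radialMode α ⊗ sin 2θ + profileRadial α ⊗ ψ₁`
(`radialMode α = (1+z)⁻¹ + O(α) = (4α)⁻¹L₁₂(F_*) + O(α)`, `profileRadial α ⊗ ψ₁ = O(α)`), with a smooth
remainder `Φ_rem` (stream function of the defect `D`) satisfying
`|∂_θθΦ_rem|²_{𝓗⁴} + |α²D_z²Φ_rem|²_{𝓗⁴} + |α²D_zΦ_rem|²_{𝓗⁴} ≤ C₂·Kα⁴` and `Φ_rem²/sin²2θ ∈ L¹_loc`. [cite: Elgindi2021, §8.3 Proposition 8.13 (p. 27 of arXiv:1904.04795); ElgindiGhoulMasmoudi2021, §2.3.1 (2.10)–(2.12) (p. 9 of arXiv:1910.14071)] -/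
theorem phiStar_structure :
    ∃ K : ℝ, 0 ≤ K ∧ ∀ α ∈ Ioc (0:ℝ) (1 / 200), ∃ Φr : ℝ → ℝ → ℝ, ContDiffOn ℝ ∞ (uncurry Φr) strip ∧
      IsStreamFunction α (defectDatum α) Φr ∧
      IsStreamFunction α (fundamentalProfile α) (fun z θ => phiApp α z θ + Φr z θ) ∧
      eHkNormSq α 4 (dθ (dθ Φr)) + eHkNormSq α 4 ((α ^ 2) • (Dz^[2] Φr)) + eHkNormSq α 4 ((α ^ 2) • Dz Φr) ≤
        thmTwoC * ENNReal.ofReal (K * α ^ 4) ∧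
      ∀ a b : ℝ, 0 < a → a < b → IntegrableOn (fun p : ℝ × ℝ => Φr p.1 p.2 ^ 2 / Real.sin (2 * p.2) ^ 2) (Ioo a b ×ˢ Ioo 0 (π / 2)) := by
  obtain ⟨K, hK0, hK⟩ := eHkNormSq_defectDatum_le
  refine ⟨K, hK0, fun α hα => ?_⟩
  obtain ⟨Φr, hs, hst, hb, hH⟩ := exists_phiRem hα.1 hα.2
  refine ⟨Φr, hs, hst, ?_, hb.trans (by gcongr; exact hK α hα), hH⟩
  have h := (isStreamFunction_phiApp hα.1 hα.2).add_of_smooth hst (contDiffOn_phiApp hα.1 hα.2) hs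
  have e : (fun z θ => (fundamentalProfile α z θ - defectDatum α z θ) + defectDatum α z θ) = fundamentalProfile α := by
    funext z θ; ring
  rw [e] at h
  exact h

end Elgindi

end Literature.Analysis.FluidPDE
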